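import Summits.CriticalPhenomena.Ising3DConformalLimit.Theses.HarmonicMomentsIsotropy
import Summits.CriticalPhenomena.Ising3DConformalLimit.Theorems.HarmonicMomentsIsotropyTwoPointAsymptoticIsotropyDilutionCharge
import Summits.CriticalPhenomena.Ising3DConformalLimit.Theorems.HarmonicMomentsIsotropyDilutionTransferInvariance
import Summits.CriticalPhenomena.Ising3DConformalLimit.Theorems.HarmonicMomentsIsotropyDilutionTransferTransfer
import Summits.CriticalPhenomena.Ising3DConformalLimit.Theorems.HarmonicMomentsIsotropyDilutionTransferDoublingB
import Summits.CriticalPhenomena.Ising3DConformalLimit.Theorems.HarmonicMomentsIsotropyTwoPointAsymptoticIsotropyLatticeIntegral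

/-!
# Vague asymptotic isotropy of the critical `ℤ³` two-point function — the DILUTION LINE:
# `HarmonicDilution → CorrelationLengthWindow → CriticalCubeCharging → TwoPointAsymptoticIsotropy`
(route HarmonicMomentsIsotropy, support item stmt-CriticalPhenomena-6036 `TwoPointAsymptoticIsotropy`)

THE RESULT. `twoPointAsymptoticIsotropy_of_dilution_charging`: if
* (HD) every cubic-harmonic anisotropy ratio of the subcritical two-point function tends to `0` as
  `β ↑ β_c` (the route decl `HarmonicDilution`, item 6034 — conclusion of the route's engine
  `AngularHierarchy` through `HierarchyClosure`),
* (CLW) the `ξ₂`-window holds (route decl `CorrelationLengthWindow`, item 6032), and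
* (CC) CUBE CHARGING of the critical mass: every sup-norm cube `{‖z - w‖_∞ ≤ r}`, `0 < r < ‖w‖_∞`,
  carries at every small mesh `δ` at least a fixed fraction of `∑_{‖δx‖_∞ ≤ 1} ⟨σ₀σₓ⟩_{β_c}`
  (a doubling / Harnack-type regularity statement about `⟨σ₀σ_x⟩_{β_c}` on `ℤ³` ALONE),
then the critical two-point function is asymptotically `O(3)`-invariant in the vague sense (the route
decl `TwoPointAsymptoticIsotropy` verbatim).  NO scaling limit, NO scale covariance and NO
reflection-positivity rigidity enter: isotropy comes from moment determinacy (Carleman) of the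
`O(3)`-invariant polynomial moments of the scaled subcritical two-point measures `ν_β`, and is
transferred to `β_c` inside the `ξ₂`-window.  This is the planner's mechanism for the glue item
`DilutionTransfer` (item 6037, whose third hypothesis was the existence crux EX, item 1981) with EX
replaced by the one lattice consequence of EX the mechanism consumes; the EX form is recovered as
`twoPointAsymptoticIsotropy_of_dilution` through the accepted `LatticeSums.cubeSum_ge_mul_ballSum`
(EX ⇒ CC).  Hence, for this milestone, the route HarmonicMomentsIsotropy needs from outside its own
cruxes (AH ⇒ HD, CLW) only the regularity statement CC — not the existence of the scaling limit.

THE PROOF.  All the analysis is in the accepted support files of item 6037 (seat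
prover-pitem-stmt-CriticalPhenomena-6037-0): `asymptotic_invariance` (HD + CLW (ii) ⇒
`∫ ψ∘T dν_β - ∫ ψ dν_β → 0`: Prokhorov, moment convergence, Fischer decomposition, moment determinacy),
`transfer_bounds` (`(1-ε) ∑ₓ ψ(x/ξ₂) G_{β_c}(x) ≤ χ ∫ ψ dν_β ≤ ∑ₓ ψ(x/ξ₂) G_{β_c}(x)` inside the window),
`exists_beta_matching_scale` (`ξ₂(β(L)) = κ L`) and the charging lemma `nu_charge_of_cubeCharging`
(file `…DilutionCharge`).  `tendsto_ratio_of_dilution_core` assembles them: given `φ`, `R`, `ε' > 0`,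
put `a = min(ε'/8, 1/4)`, take the CLW (i) scale `s` at `ε = a` and
`κ = max(9B_φ/√s, 3(‖v₁‖ + r₁)/√s₁)` (supports of `ψ = φ(κ ·)`, `ψ ∘ R` inside the window at scale `ξ₂`;
positivity cube of `ψ` admissible for the charging), and `b < β_c` beyond which
`|∫ ψ∘T dν_β - ∫ ψ dν_β| ≤ a m ι ≤ a ∫ ψ dν_β`; for `L ≥ L₀(b)` pick `β` with `ξ₂(β) = κL`: both lattice
sums are within the factor `1 - a` of `χ ∫ ψ∘T dν_β`, `χ ∫ ψ dν_β`, so `|ratio - 1| ≤ 3a < ε'`.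

References: M. Campostrini, A. Pelissetto, P. Rossi, E. Vicari, Phys. Rev. E 57 (1998) 184, §2
(harmonic moments and the restoration of rotational invariance) [CampostriniEtAl1998];
H. Duminil-Copin, ICM 2022, §8.1 (the open problem) [DuminilCopinICM2022].  No definitions.
-/

noncomputable section

open MeasureTheory Filter Topology Set
open scoped ENNReal NNReal BigOperators
open Literature.Probability.LatticeModels
open Summit.CriticalPhenomena.Ising3DConformalLimit.Theorems.HarmonicMomentsIsotropy
open Summit.CriticalPhenomena.Ising3DConformalLimit.Theses.HarmonicMomentsIsotropy

namespace Summit.CriticalPhenomena.Ising3DConformalLimit.HarmonicMomentsIsotropyTwoPoint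

open scoped Classical

/-! ## Bookkeeping -/

/-- The final arithmetic of the window transfer: if `I ≤ D ≤ I/(1-a)`, `I_T ≤ N ≤ I_T/(1-a)`,
`|I_T - I| ≤ a I` with `I > 0` and `0 < a ≤ 1/4`, then `|N/D - 1| ≤ 3a`. -/
theorem ratio_window_arith {a I IT D N : ℝ} (ha0 : 0 < a) (ha4 : a ≤ 1 / 4) (hI : 0 < I)
    (hD1 : I ≤ D) (hD2 : (1 - a) * D ≤ I) (hN1 : IT ≤ N) (hN2 : (1 - a) * N ≤ IT)
    (hρ : |IT - I| ≤ a * I) : |N / D - 1| ≤ 3 * a := by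
  have hD : 0 < D := lt_of_lt_of_le hI hD1
  obtain ⟨h1, h2⟩ := abs_le.1 hρ
  rw [abs_le]
  constructor
  · -- `N ≥ IT ≥ (1-a) I ≥ (1-a)² D ≥ (1-2a) D`
    have hN : (1 - 2 * a) * D ≤ N := by nlinarith
    rw [le_sub_iff_add_le, le_div_iff₀ hD]
    nlinarith
  · -- `N ≤ IT/(1-a) ≤ (1+a) I/(1-a) ≤ (1+a) D/(1-a) ≤ (1+3a) D`
    have h1a : 0 < 1 - a := by linarith
    have hN : (1 - a) * N ≤ (1 + a) * D := by nlinarith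
    rw [sub_le_iff_le_add, div_le_iff₀ hD]
    nlinarith

/-- The sup norm of `v : Fin 3 → ℝ` is at most the Euclidean radius: `‖v‖² ≤ ∑ᵢ vᵢ²`. -/
theorem norm_sq_le_sum_sq (v : Fin 3 → ℝ) : ‖v‖ ^ 2 ≤ ∑ i, (v i) ^ 2 := by
  have h : ‖v‖ ≤ Real.sqrt (∑ i, (v i) ^ 2) := by
    refine (pi_norm_le_iff_of_nonneg (Real.sqrt_nonneg _)).2 fun i => ?_
    rw [Real.norm_eq_abs]
    refine Real.abs_le_sqrt ?_
    exact Finset.single_le_sum (f := fun j => (v j) ^ 2) (fun j _ => sq_nonneg _)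
      (Finset.mem_univ i)
  calc ‖v‖ ^ 2 ≤ Real.sqrt (∑ i, (v i) ^ 2) ^ 2 := pow_le_pow_left₀ (norm_nonneg _) h 2
    _ = ∑ i, (v i) ^ 2 := Real.sq_sqrt (Finset.sum_nonneg fun _ _ => sq_nonneg _)

/-- Extracting a left neighbourhood: an eventual property at `β_c⁻` holds on some `(b, β_c)`. -/
theorem exists_Ioo_of_eventually_nhdsLT {p : ℝ → Prop}
    (h : ∀ᶠ β in 𝓝[<] (criticalBeta 3), p β) :
    ∃ b < criticalBeta 3, ∀ β, b < β → β < criticalBeta 3 → p β := by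
  obtain ⟨b, hb, hsub⟩ := mem_nhdsLT_iff_exists_Ioo_subset.1 h
  exact ⟨b, hb, fun β h1 h2 => hsub ⟨h1, h2⟩⟩

/-! ## The dilution line -/

/-- **The core of the dilution line.** From harmonic dilution (in the explicit form of the support
files), both halves of the `ξ₂`-window, and CHARGING of the scaled subcritical two-point measures
(`ν_β` gives every small sup-norm cube avoiding the origin, inside the critical window `9(‖w‖+r)² ≤ s₁`,
a mass bounded below as `β ↑ β_c`), the isotropy ratio of the critical two-point function tends to `1`
for every admissible test function `φ` and orthogonal matrix `R`. -/
theorem tendsto_ratio_of_dilution_core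
    (hHD' : ∀ (n m : ℕ) (Y : MvPolynomial (Fin 3) ℝ), 1 ≤ n → Y.IsHomogeneous n →
      (∑ i : Fin 3, MvPolynomial.pderiv i (MvPolynomial.pderiv i Y)) = 0 →
      Tendsto (fun β => (∑' x : Site 3, MvPolynomial.eval (fun i => ((x i : ℤ) : ℝ)) Y *
          Real.sqrt (∑ i, ((x i : ℤ) : ℝ) ^ 2) ^ (2 * m) * twoPointFree 3 β x) /
        (∑' x : Site 3, Real.sqrt (∑ i, ((x i : ℤ) : ℝ) ^ 2) ^ (n + 2 * m) * twoPointFree 3 β x))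
        (𝓝[<] (criticalBeta 3)) (𝓝 0))
    (hi : ∀ ε : ℝ, 0 < ε → ∃ s : ℝ, 0 < s ∧ ∃ β₁ : ℝ, β₁ < criticalBeta 3 ∧
      ∀ β : ℝ, β₁ ≤ β → β < criticalBeta 3 → ∀ x : Site 3,
        (∑ i, ((x i : ℤ) : ℝ) ^ 2) * chi β ≤ s * msq β →
          (1 - ε) * criticalTwoPoint 3 x ≤ twoPointFree 3 β x)
    {c₀ C β₀ : ℝ} (hc₀ : 0 < c₀) (hβ₀ : β₀ < criticalBeta 3)
    (hii : ∀ β : ℝ, β₀ ≤ β → β < criticalBeta 3 → ∀ A : ℝ, 1 ≤ A →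
      (∑' x : Site 3, if A ^ 2 * msq β < (∑ i, ((x i : ℤ) : ℝ) ^ 2) * chi β
        then twoPointFree 3 β x else 0) ≤ C * Real.exp (-(c₀ * A)) * chi β)
    {s₁ : ℝ} (hs₁ : 0 < s₁)
    (hchargeQ : ∀ (w : Fin 3 → ℝ) (r : ℝ), 0 < r → r < ‖w‖ → 9 * (‖w‖ + r) ^ 2 ≤ s₁ →
      ∃ ι > 0, ∀ᶠ β in 𝓝[<] (criticalBeta 3),
        ι ≤ ((nu β) {y | WithLp.ofLp y ∈ Metric.closedBall w r}).toReal)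
    {φ : (Fin 3 → ℝ) → ℝ} (hφc : Continuous φ) (hφs : HasCompactSupport φ) (hφ0 : ∀ v, 0 ≤ φ v)
    (hφpos : ∃ v, 0 < φ v) (R : Matrix.orthogonalGroup (Fin 3) ℝ) :
    Tendsto (fun L : ℝ => (∑' x : Site 3, φ (L⁻¹ • (R.1.mulVec (fun i => (x i : ℝ)))) *
        criticalTwoPoint 3 x) / (∑' x : Site 3, φ (L⁻¹ • (fun i => (x i : ℝ))) *
        criticalTwoPoint 3 x)) atTop (𝓝 1) := by
  -- data of the test function
  obtain ⟨B, hB, hsupp⟩ := exists_support_bound hφs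
  obtain ⟨v₁, r₁, m, hv₁, hr₁, hr₁v, hm, hcube⟩ := exists_pos_cube hφc hφpos
  obtain ⟨Cφ, hCφ⟩ := hφc.bounded_above_of_compact_support hφs
  have hv₁n : 0 < ‖v₁‖ := norm_pos_iff.2 hv₁
  -- the isometry of `R`
  obtain ⟨T, hT⟩ := exists_linearIsometryEquiv_of_orthogonal R
  -- `ξ₂ → ∞`
  have hξ := tendsto_xi_atTop hc₀ hβ₀ hii
  rw [Metric.tendsto_atTop]
  intro ε' hε'
  -- the accuracy `a` and CLW (i) at `ε = a`
  set a : ℝ := min (ε' / 8) (1 / 4) with ha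
  have ha0 : 0 < a := lt_min (by positivity) (by norm_num)
  have ha4 : a ≤ 1 / 4 := min_le_right _ _; have ha8 : a ≤ ε' / 8 := min_le_left _ _
  obtain ⟨s, hs, β₂, hβ₂, hi2⟩ := hi a ha0
  -- the scale factor `κ`
  set κ : ℝ := max (9 * B / Real.sqrt s) (3 * (‖v₁‖ + r₁) / Real.sqrt s₁) with hκ
  have hsq : 0 < Real.sqrt s := Real.sqrt_pos.2 hs; have hsq₁ : 0 < Real.sqrt s₁ := Real.sqrt_pos.2 hs₁
  have hκpos : 0 < κ := lt_of_lt_of_le (by positivity) (le_max_left _ _)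
  have hκ1 : 9 * B / Real.sqrt s ≤ κ := le_max_left _ _
  have hκ2 : 3 * (‖v₁‖ + r₁) / Real.sqrt s₁ ≤ κ := le_max_right _ _
  -- the test functions at scale `κ`
  set ψ : (Fin 3 → ℝ) → ℝ := fun v => φ (κ • v) with hψ
  set ψR : (Fin 3 → ℝ) → ℝ := fun v => ψ (R.1.mulVec v) with hψR
  set ψV : V → ℝ := fun y => ψ (WithLp.ofLp y) with hψV
  have hψc : Continuous ψ := hφc.comp (continuous_const_smul κ)
  have hmulVec : Continuous fun v : Fin 3 → ℝ => R.1.mulVec v :=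
    Continuous.matrix_mulVec continuous_const continuous_id
  have hψRc : Continuous ψR := hψc.comp hmulVec
  have hψVc : Continuous ψV := hψc.comp (PiLp.continuous_ofLp 2 _)
  have hψ0 : ∀ v, 0 ≤ ψ v := fun v => hφ0 _; have hψR0 : ∀ v, 0 ≤ ψR v := fun v => hφ0 _
  have hψb : ∀ v, |ψ v| ≤ Cφ := fun v => by rw [← Real.norm_eq_abs]; exact hCφ _
  have hψRb : ∀ v, |ψR v| ≤ Cφ := fun v => hψb _; have hψVb : ∀ y, |ψV y| ≤ Cφ := fun y => hψb _
  -- supports: `ψ v ≠ 0 → ‖v‖ < B/κ`, `ψR v ≠ 0 → ‖v‖ < 2B/κ`, and the Euclidean radii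
  have hψs : ∀ v, ψ v ≠ 0 → ‖v‖ < B / κ := by
    intro v hv
    have h := hsupp _ hv
    rw [norm_smul, Real.norm_eq_abs, abs_of_pos hκpos] at h
    rwa [lt_div_iff₀ hκpos, mul_comm]
  have hψr2 : ∀ v, ψ v ≠ 0 → (∑ i, (v i) ^ 2) < 3 * (B / κ) ^ 2 := by
    intro v hv
    have h := hψs v hv
    calc (∑ i, (v i) ^ 2) ≤ 3 * ‖v‖ ^ 2 := sum_sq_le_three_mul_norm_sq v
      _ < 3 * (B / κ) ^ 2 := by gcongr
  have hψRr2 : ∀ v, ψR v ≠ 0 → (∑ i, (v i) ^ 2) < 3 * (B / κ) ^ 2 := by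
    intro v hv
    rw [← sum_sq_mulVec_eq R v]
    exact hψr2 _ hv
  have hψRs : ∀ v, ψR v ≠ 0 → ‖v‖ < 2 * B / κ := by
    intro v hv
    have h := hψRr2 v hv
    have hn : ‖v‖ ^ 2 < (2 * B / κ) ^ 2 := by
      calc ‖v‖ ^ 2 ≤ ∑ i, (v i) ^ 2 := norm_sq_le_sum_sq v
        _ < 3 * (B / κ) ^ 2 := h
        _ ≤ (2 * B / κ) ^ 2 := by
            rw [show (2 * B / κ) ^ 2 = 4 * (B / κ) ^ 2 by ring]; nlinarith [sq_nonneg (B / κ)]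
    exact lt_of_pow_lt_pow_left₀ 2 (by positivity) hn
  -- the window condition at scale `ξ₂`: Euclidean radius `< 3B²ξ₂²/κ² ≤ s ξ₂²`
  have hBκ : 3 * (B / κ) ^ 2 ≤ s / 9 := by
    have h1 : B / κ ≤ Real.sqrt s / 9 := by
      rw [div_le_iff₀ hκpos]
      have := (div_le_iff₀ hsq).1 hκ1
      nlinarith
    have h2 : 0 ≤ B / κ := by positivity
    calc 3 * (B / κ) ^ 2 ≤ 3 * (Real.sqrt s / 9) ^ 2 := by gcongr
      _ = s / 27 := by rw [div_pow, Real.sq_sqrt hs.le]; ring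
      _ ≤ s / 9 := by linarith
  have hwindow : ∀ {β : ℝ}, 0 ≤ β → β < criticalBeta 3 → β₂ ≤ β → 0 < xi β →
      ∀ (g : (Fin 3 → ℝ) → ℝ), (∀ v, g v ≠ 0 → (∑ i, (v i) ^ 2) < 3 * (B / κ) ^ 2) →
      ∀ x : Site 3, g ((xi β)⁻¹ • siteW x) ≠ 0 →
        (1 - a) * criticalTwoPoint 3 x ≤ twoPointFree 3 β x := by
    intro β hβ hβc hβ₂β hξβ g hg x hx
    refine hi2 β hβ₂β hβc x ?_
    have h := hg _ hx
    have hcoord : (∑ i, (((xi β)⁻¹ • siteW x) i) ^ 2) = (xi β)⁻¹ ^ 2 * ∑ i, ((x i : ℤ) : ℝ) ^ 2 := by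
      rw [Finset.mul_sum]
      refine Finset.sum_congr rfl fun i _ => ?_
      simp [siteW, mul_pow]
    rw [hcoord] at h
    have hχ := chi_pos hβ hβc
    have hξ2 : xi β ^ 2 * chi β = msq β := by
      rw [xi_sq hβ hβc]; field_simp
    -- `∑ xᵢ² < 3B²/κ² · ξ² ≤ (s/9) ξ² ≤ s ξ²`
    have h' : (∑ i, ((x i : ℤ) : ℝ) ^ 2) ≤ s * xi β ^ 2 := by
      have hx2 : (xi β)⁻¹ ^ 2 * (∑ i, ((x i : ℤ) : ℝ) ^ 2) < s / 9 := lt_of_lt_of_le h hBκ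
      rw [inv_pow, inv_mul_lt_iff₀ (by positivity)] at hx2
      nlinarith [sq_nonneg (xi β), hs.le]
    calc (∑ i, ((x i : ℤ) : ℝ) ^ 2) * chi β ≤ s * xi β ^ 2 * chi β :=
        mul_le_mul_of_nonneg_right h' hχ.le
      _ = s * msq β := by rw [mul_assoc, hξ2]
  -- charging of the positivity cube of `ψ`
  set w : Fin 3 → ℝ := κ⁻¹ • v₁ with hw
  have hnw : ‖w‖ = ‖v₁‖ / κ := by
    rw [hw, norm_smul, Real.norm_eq_abs, abs_of_pos (inv_pos.2 hκpos), div_eq_inv_mul]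
  have hrw : r₁ / κ < ‖w‖ := by
    rw [hnw]; gcongr; linarith
  have hws : 9 * (‖w‖ + r₁ / κ) ^ 2 ≤ s₁ := by
    rw [hnw, ← add_div]
    have h1 : (‖v₁‖ + r₁) / κ ≤ Real.sqrt s₁ / 3 := by
      rw [div_le_iff₀ hκpos]
      have := (div_le_iff₀ hsq₁).1 hκ2
      nlinarith
    have h2 : 0 ≤ (‖v₁‖ + r₁) / κ := by positivity
    calc 9 * ((‖v₁‖ + r₁) / κ) ^ 2 ≤ 9 * (Real.sqrt s₁ / 3) ^ 2 := by gcongr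
      _ = s₁ := by rw [div_pow, Real.sq_sqrt hs₁.le]; ring
  obtain ⟨ι, hι, hcharge⟩ := hchargeQ w (r₁ / κ) (by positivity) hrw hws
  -- `ψ ≥ m` on that cube (read in `V`)
  have hψcube : ∀ y : V, WithLp.ofLp y ∈ Metric.closedBall w (r₁ / κ) → m ≤ ψV y := by
    intro y hy
    refine hcube _ ?_
    rw [Metric.mem_closedBall, dist_eq_norm] at hy ⊢
    have : κ • WithLp.ofLp y - v₁ = κ • (WithLp.ofLp y - w) := by
      rw [smul_sub, hw, smul_smul, mul_inv_cancel₀ hκpos.ne', one_smul]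
    rw [this, norm_smul, Real.norm_eq_abs, abs_of_pos hκpos]
    calc κ * ‖WithLp.ofLp y - w‖ ≤ κ * (r₁ / κ) := mul_le_mul_of_nonneg_left hy hκpos.le
      _ = r₁ := by field_simp
  -- asymptotic invariance of `ν_β` tested against `ψV` and `T`
  have hinv := asymptotic_invariance hHD' hc₀ hβ₀ hii ψV hψVc hψVb T
  have hsmall : ∀ᶠ β in 𝓝[<] (criticalBeta 3),
      |(∫ y, ψV (T y) ∂(nu β)) - ∫ y, ψV y ∂(nu β)| < a * (m * ι) := by
    have h := (Metric.tendsto_nhds.1 hinv) (a * (m * ι)) (by positivity)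
    filter_upwards [h] with β hβ
    rwa [Real.dist_eq, sub_zero] at hβ
  have hrange : ∀ᶠ β in 𝓝[<] (criticalBeta 3), max β₂ 0 < β ∧ β < criticalBeta 3 := by
    have : Ioo (max β₂ 0) (criticalBeta 3) ∈ 𝓝[<] (criticalBeta 3) :=
      Ioo_mem_nhdsLT (max_lt hβ₂ (criticalBeta_pos_holds (d := 3) (by norm_num)))
    filter_upwards [this] with β hβ using hβ
  obtain ⟨b, hb, hgood⟩ := exists_Ioo_of_eventually_nhdsLT ((hsmall.and hcharge).and hrange)
  -- matching the scales: `ξ₂(β) = κ L`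
  obtain ⟨L₀, hL₀⟩ := exists_beta_matching_scale hξ hκpos hb
  refine ⟨max L₀ 1, fun L hL => ?_⟩
  have hLpos : 0 < L := lt_of_lt_of_le one_pos (le_trans (le_max_right _ _) hL)
  obtain ⟨β, hbβ, hβc, hξβ⟩ := hL₀ L (le_trans (le_max_left _ _) hL)
  obtain ⟨⟨hsmallβ, hchargeβ⟩, hrβ, -⟩ := hgood β hbβ hβc
  have hβpos : 0 < β := lt_of_le_of_lt (le_max_right _ _) hrβ
  have hβ₂β : β₂ ≤ β := (le_max_left _ _).trans hrβ.le
  have hξpos : 0 < xi β := by rw [hξβ]; positivity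
  have hχ := chi_pos hβpos.le hβc
  -- the transfer bounds for `ψ` and `ψR`
  obtain ⟨-, hD2, hD1⟩ := transfer_bounds hβpos.le hβc hξpos ψ hψ0 hψc.measurable hψb hψs
    (hwindow hβpos.le hβc hβ₂β hξpos ψ hψr2)
  obtain ⟨-, hN2, hN1⟩ := transfer_bounds hβpos.le hβc hξpos ψR hψR0 hψRc.measurable hψRb hψRs
    (hwindow hβpos.le hβc hβ₂β hξpos ψR hψRr2)
  -- the integrals: `∫ ψR∘ofLp dν = ∫ ψV∘T dν`, and `∫ ψV dν ≥ m ι`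
  have hIT : ∫ y, ψR (WithLp.ofLp y) ∂(nu β) = ∫ y, ψV (T y) ∂(nu β) := by
    refine integral_congr_ae (ae_of_all _ fun y => ?_)
    simp only [hψR, hψV, hT]
  have hIψ : ∫ y, ψ (WithLp.ofLp y) ∂(nu β) = ∫ y, ψV y ∂(nu β) := rfl
  haveI : IsProbabilityMeasure (nu β) := isProbabilityMeasure_nu hβpos.le hβc
  have hmeas_cube : MeasurableSet {y : V | WithLp.ofLp y ∈ Metric.closedBall w (r₁ / κ)} :=
    measurableSet_closedBall.preimage (PiLp.continuous_ofLp 2 _).measurable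
  have hψVint : Integrable ψV (nu β) :=
    integrable_nu hβpos.le hβc (hψVc.measurable) (A := 0) (B := Cφ) (q := 0)
      (fun y => by simpa using hψVb y)
  have hIlow : m * ι ≤ ∫ y, ψV y ∂(nu β) := by
    have h1 : m * ι ≤ m * ((nu β) {y : V | WithLp.ofLp y ∈ Metric.closedBall w (r₁ / κ)}).toReal :=
      mul_le_mul_of_nonneg_left hchargeβ hm.le
    refine h1.trans ?_
    have h2 : ∫ y, m * ({y : V | WithLp.ofLp y ∈ Metric.closedBall w (r₁ / κ)}.indicator 1 y)
        ∂(nu β) = m * ((nu β) {y : V | WithLp.ofLp y ∈ Metric.closedBall w (r₁ / κ)}).toReal := by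
      rw [integral_const_mul, integral_indicator_one hmeas_cube]
      rfl
    rw [← h2]
    have hind : Integrable
        (fun y : V => m * ({y : V | WithLp.ofLp y ∈ Metric.closedBall w (r₁ / κ)}.indicator 1 y))
        (nu β) :=
      ((integrable_const (1 : ℝ)).indicator hmeas_cube).const_mul m
    refine integral_mono hind hψVint fun y => ?_
    by_cases hy : WithLp.ofLp y ∈ Metric.closedBall w (r₁ / κ)
    · have h1 : ({y : V | WithLp.ofLp y ∈ Metric.closedBall w (r₁ / κ)}.indicator
          (1 : V → ℝ) y) = 1 :=
        indicator_of_mem (show y ∈ {y : V | WithLp.ofLp y ∈ Metric.closedBall w (r₁ / κ)} from hy) _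
      simp only [h1, mul_one]; exact hψcube y hy
    · have h1 : ({y : V | WithLp.ofLp y ∈ Metric.closedBall w (r₁ / κ)}.indicator
          (1 : V → ℝ) y) = 0 :=
        indicator_of_notMem (show y ∉ {y : V | WithLp.ofLp y ∈ Metric.closedBall w (r₁ / κ)} from hy) _
      simp only [h1, mul_zero]; exact hψ0 _
  have hIpos : 0 < chi β * ∫ y, ψV y ∂(nu β) := mul_pos hχ (lt_of_lt_of_le (by positivity) hIlow)
  -- `|I_T - I| ≤ a I`
  have hρ : |chi β * ∫ y, ψV (T y) ∂(nu β) - chi β * ∫ y, ψV y ∂(nu β)| ≤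
      a * (chi β * ∫ y, ψV y ∂(nu β)) := by
    rw [← mul_sub, abs_mul, abs_of_pos hχ, mul_left_comm]
    refine mul_le_mul_of_nonneg_left ?_ hχ.le
    calc |(∫ y, ψV (T y) ∂(nu β)) - ∫ y, ψV y ∂(nu β)| ≤ a * (m * ι) := hsmallβ.le
      _ ≤ a * ∫ y, ψV y ∂(nu β) := mul_le_mul_of_nonneg_left hIlow ha0.le
  -- identify the lattice sums of the ratio with the transferred sums
  have hscale : κ * (xi β)⁻¹ = L⁻¹ := by
    rw [hξβ, mul_inv, ← mul_assoc, mul_inv_cancel₀ hκpos.ne', one_mul]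
  have hDsum : (∑' x : Site 3, φ (L⁻¹ • fun i => ((x i : ℤ) : ℝ)) * criticalTwoPoint 3 x) =
      ∑' x : Site 3, ψ ((xi β)⁻¹ • siteW x) * criticalTwoPoint 3 x := by
    refine tsum_congr fun x => ?_
    simp only [hψ, smul_smul, hscale]
    rfl
  have hNsum : (∑' x : Site 3, φ (L⁻¹ • R.1.mulVec fun i => ((x i : ℤ) : ℝ)) *
      criticalTwoPoint 3 x) = ∑' x : Site 3, ψR ((xi β)⁻¹ • siteW x) * criticalTwoPoint 3 x := by
    refine tsum_congr fun x => ?_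
    simp only [hψR, hψ, Matrix.mulVec_smul, smul_smul, hscale]
    rfl
  rw [Real.dist_eq, hDsum, hNsum]
  rw [hIT] at hN1 hN2
  have key := ratio_window_arith ha0 ha4 hIpos hD1 hD2 hN1 hN2 hρ
  calc |(∑' x : Site 3, ψR ((xi β)⁻¹ • siteW x) * criticalTwoPoint 3 x) /
        (∑' x : Site 3, ψ ((xi β)⁻¹ • siteW x) * criticalTwoPoint 3 x) - 1| ≤ 3 * a := key
    _ < ε' := by linarith

/-- **`HarmonicDilution → CorrelationLengthWindow → CriticalCubeCharging → TwoPointAsymptoticIsotropy`.**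
If every cubic-harmonic anisotropy ratio of the subcritical two-point function on `ℤ³` tends to `0`
as `β ↑ β_c` (route decl `HarmonicDilution`), the `ξ₂`-window holds (route decl
`CorrelationLengthWindow`) and the critical two-point mass charges cubes (for every sup-norm cube
`{‖z - w‖_∞ ≤ r}` with `0 < r < ‖w‖_∞` there are `q > 0`, `δ₀ > 0` with
`q ∑_{‖δx‖_∞≤1} ⟨σ₀σₓ⟩_{β_c} ≤ ∑_{δx ∈ cube} ⟨σ₀σₓ⟩_{β_c}` for `0 < δ < δ₀`), then for every continuous
compactly supported `φ ≥ 0`, `φ ≢ 0`, on `ℝ³` and every orthogonal `R`,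
`∑ₓ φ(Rx/L)⟨σ₀σₓ⟩_{β_c} / ∑ₓ φ(x/L)⟨σ₀σₓ⟩_{β_c} → 1` as `L → ∞` (route decl `TwoPointAsymptoticIsotropy`
verbatim).  No scaling limit and no reflection positivity are used. [cite: CampostriniEtAl1998, §2] -/
theorem twoPointAsymptoticIsotropy_of_dilution_charging (hHD : HarmonicDilution)
    (hCLW : CorrelationLengthWindow)
    (hD : ∀ (w : Fin 3 → ℝ) (r : ℝ), 0 < r → r < ‖w‖ → ∃ q : ℝ, 0 < q ∧ ∃ δ₀ : ℝ, 0 < δ₀ ∧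
      ∀ δ : ℝ, 0 < δ → δ < δ₀ →
        q * (∑' x : Site 3, if (δ • fun i => ((x i : ℤ) : ℝ)) ∈
            Metric.closedBall (0 : Fin 3 → ℝ) 1 then criticalTwoPoint 3 x else 0) ≤
          ∑' x : Site 3, (if (δ • fun i => ((x i : ℤ) : ℝ)) ∈ Metric.closedBall w r
            then criticalTwoPoint 3 x else 0)) :
    TwoPointAsymptoticIsotropy := by
  intro φ hφc hφs hφ0 hφpos R
  -- the route hypotheses in the form of the support files
  have hHD' : ∀ (n m : ℕ) (Y : MvPolynomial (Fin 3) ℝ), 1 ≤ n → Y.IsHomogeneous n →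
      (∑ i : Fin 3, MvPolynomial.pderiv i (MvPolynomial.pderiv i Y)) = 0 →
      Tendsto (fun β => (∑' x : Site 3, MvPolynomial.eval (fun i => ((x i : ℤ) : ℝ)) Y *
          Real.sqrt (∑ i, ((x i : ℤ) : ℝ) ^ 2) ^ (2 * m) * twoPointFree 3 β x) /
        (∑' x : Site 3, Real.sqrt (∑ i, ((x i : ℤ) : ℝ) ^ 2) ^ (n + 2 * m) * twoPointFree 3 β x))
        (𝓝[<] (criticalBeta 3)) (𝓝 0) := hHD
  obtain ⟨hi, c₀, C, hc₀, β₀, hβ₀, hii⟩ := hCLW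
  change ∀ ε : ℝ, 0 < ε → ∃ s : ℝ, 0 < s ∧ ∃ β₁ : ℝ, β₁ < criticalBeta 3 ∧
      ∀ β : ℝ, β₁ ≤ β → β < criticalBeta 3 → ∀ x : Site 3,
        (∑ i, ((x i : ℤ) : ℝ) ^ 2) * chi β ≤ s * msq β →
          (1 - ε) * criticalTwoPoint 3 x ≤ twoPointFree 3 β x at hi
  change ∀ β : ℝ, β₀ ≤ β → β < criticalBeta 3 → ∀ A : ℝ, 1 ≤ A →
      (∑' x : Site 3, if A ^ 2 * msq β < (∑ i, ((x i : ℤ) : ℝ) ^ 2) * chi β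
        then twoPointFree 3 β x else 0) ≤ C * Real.exp (-(c₀ * A)) * chi β at hii
  -- CLW (i) at `ε = 1/2` feeds the charging lemma
  obtain ⟨s₁, hs₁, β₁, hβ₁, hi1⟩ := hi (1 / 2) (by norm_num)
  have hi1' : ∀ β : ℝ, β₁ ≤ β → β < criticalBeta 3 → ∀ x : Site 3,
      (∑ i, ((x i : ℤ) : ℝ) ^ 2) * chi β ≤ s₁ * msq β →
        (1 / 2 : ℝ) * criticalTwoPoint 3 x ≤ twoPointFree 3 β x := fun β h1 h2 x hx =>
    calc (1 / 2 : ℝ) * criticalTwoPoint 3 x = (1 - 1 / 2) * criticalTwoPoint 3 x := by norm_num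
      _ ≤ twoPointFree 3 β x := hi1 β h1 h2 x hx
  exact tendsto_ratio_of_dilution_core hHD' hi hc₀ hβ₀ hii hs₁
    (fun w r hr hrw hws => nu_charge_of_cubeCharging hD hβ₁ hi1' hc₀ hβ₀ hii w hr hrw hws)
    hφc hφs hφ0 hφpos R

/-- **`HarmonicDilution → CorrelationLengthWindow → ExistsScaleCovariantLimit → TwoPointAsymptoticIsotropy`
by the dilution mechanism** (the planner's proof of the glue `DilutionTransfer`, item
stmt-CriticalPhenomena-6037, kernel-checked end to end): the existence crux EX enters only through
cube charging of the critical mass (`LatticeSums.cubeSum_ge_mul_ballSum`).  (Item 6037 itself is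
already closed by the shorter `dilutionTransfer_proof`, which discards the first two hypotheses and
uses reflection-positivity rigidity instead.) [cite: CampostriniEtAl1998, §2] -/
theorem twoPointAsymptoticIsotropy_of_dilution (hHD : HarmonicDilution)
    (hCLW : CorrelationLengthWindow) (hEX : ExistsScaleCovariantLimit) :
    TwoPointAsymptoticIsotropy := by
  obtain ⟨ρ, Δ, S, hρ, -, hlim, -, hnd, -, hsc⟩ := hEX
  refine twoPointAsymptoticIsotropy_of_dilution_charging hHD hCLW fun w r hr hrw => ?_
  obtain ⟨q, hq, δ₀, hδ₀, h⟩ := LatticeSums.cubeSum_ge_mul_ballSum hρ hlim hsc hnd w hr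
    (η := (‖w‖ - r) / 2) (by linarith) (by linarith)
  exact ⟨q, hq, δ₀, hδ₀, h⟩

end Summit.CriticalPhenomena.Ising3DConformalLimit.HarmonicMomentsIsotropyTwoPoint

end
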